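import Summits.QuantumFields.GaugeBoot.BootstrapSymmetryConsequences
import Summits.QuantumFields.GaugeBoot.WilsonLineObservables
import HarnessLib

/-!
# Internal symmetries of the bootstrap III: the centre sheet twist (finite-volume centre symmetry) (gauge-boot, L1 supplement)

HONEST FRAMING (cell `pub-gaugeboot`, page 1 of every file): the venture produces certified bounds
on lattice expectations at stated coupling, gauge group, dimension and torus size; NOT a mass gap,
NOT a continuum limit, NOT a string tension; NOT Yang–Mills-summit-bearing (barriers
`FixedCouplingUltralocality`, `PerturbativeInvisibility`). Structural; it certifies no number.

## Content

The CENTRE SYMMETRY of pure lattice gauge theory on the torus `(ℤ/L)^d`: multiply every link in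
direction `m` emanating from the sheet `{x_m = 0}` by a fixed CENTRAL element `z` of the gauge group
(`sheetTwistCM m z`). Every plaquette contains its sheet links in cancelling pairs, so

* `plaquetteHolonomy_sheetTwist`, `wilsonAction_sheetTwist` — plaquette holonomies and the Wilson
  action are unchanged (any group, `z` central);
* `measurePreserving_sheetTwistEquiv_wilsonMeasure`, `integral_comp_sheetTwist_eq_wilson` — the Wilson
  measure is invariant (left invariance of Haar measure link by link, `measurePreserving_pi`);
* `comp_sheetTwistCM_mem_polyAlgebra` — the polynomial observables are stable (a twisted link is a
  one-link left shift, `comp_shiftCM_mem_polyAlgebra`);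
* ★★★ `bootstrap_sheetTwistInvariant_suN` / `_uN` — every solution of the untruncated `SU(N)` /
  `U(N)` bootstrap is invariant under every centre sheet twist (`bootstrap_invariant_suN`);
* `wordHolonomy_polyakov_sheetTwist` — a POLYAKOV LOOP (the straight word of `L` steps in direction
  `m`) based on the sheet picks up exactly one factor `z`.

The sequel `BootstrapCentreSymmetry.lean` takes `z = e^{2πi/N}·1 ∈ SU(N)` and concludes that every
bootstrap solution — in particular the Wilson state — assigns `0` to every Polyakov loop (`N ≥ 2`):
the tree's `ℤ₂` statement `wilsonExpectation_polyakovLine_eq_zero` (`TorusCentreSymmetry`, `SU(2n)`,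
`U(N)`) extended to the full centre `ℤ_N`.

References: A. M. Polyakov, Phys. Lett. B 72 (1978) 477; G. 't Hooft, Nucl. Phys. B 153 (1979) 141;
B. Svetitsky, L. Yaffe, Nucl. Phys. B 210 (1982) 423. Folklore.
-/

noncomputable section

open MeasureTheory Filter Topology NormedSpace
open Literature.MathematicalPhysics.QuantumFieldTheory (haarProbability LatticeRep Site Edge GaugeConfig
  plaquetteHolonomy wilsonAction wilsonWeight wilsonMeasure withDensity_map_of_measurableEquiv)

namespace Summit.QuantumFields.GaugeBoot

/-! ## The sheet twist -/

section Twist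

variable {d L : ℕ} {G : Type*} [Group G]

/-- **The twist factor** of the link `e` for the sheet `{x_m = 0}`: `z` on the links `(x, m)` with
`x_m = 0`, `1` elsewhere. [folklore] -/
def sheetFactor (m : Fin d) (z : G) (e : Edge d L) : G := if e.2 = m ∧ e.1 m = 0 then z else 1

/-- **The centre sheet twist** `U ↦ (sheetFactor · * U ·)`. [folklore] -/
def sheetTwist (m : Fin d) (z : G) (U : GaugeConfig d L G) : GaugeConfig d L G := fun e => sheetFactor m z e * U e

/-- `sheetTwist` evaluated. -/
@[simp] theorem sheetTwist_apply (m : Fin d) (z : G) (U : GaugeConfig d L G) (e : Edge d L) :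
    sheetTwist m z U e = sheetFactor m z e * U e := rfl

/-- The twist factors are central when `z` is. -/
theorem sheetFactor_comm {m : Fin d} {z : G} (hz : z ∈ Subgroup.center G) (e : Edge d L) (g : G) :
    sheetFactor (L := L) m z e * g = g * sheetFactor (L := L) m z e := by
  unfold sheetFactor
  split_ifs
  · exact (Subgroup.mem_center_iff.1 hz g).symm
  · rw [one_mul, mul_one]

/-- Twisting by `z⁻¹` undoes twisting by `z`. -/
theorem sheetTwist_inv_sheetTwist (m : Fin d) (z : G) (U : GaugeConfig d L G) :
    sheetTwist m z⁻¹ (sheetTwist m z U) = U := by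
  funext e
  simp only [sheetTwist_apply, sheetFactor]
  split_ifs <;> simp

/-- Twisting by `z` undoes twisting by `z⁻¹`. -/
theorem sheetTwist_sheetTwist_inv (m : Fin d) (z : G) (U : GaugeConfig d L G) :
    sheetTwist m z (sheetTwist m z⁻¹ U) = U := by
  simpa using sheetTwist_inv_sheetTwist m z⁻¹ U

/-- A shift in a direction other than `m` does not change the `m`-coordinate. -/
theorem shift_apply_of_ne' (x : Site d L) {j m : Fin d} (h : j ≠ m) : (x.shift j) m = x m := by
  simp [Site.shift, h.symm]

/-- Pulling a central inverse out of a tail: `g c⁻¹ = c⁻¹ g`. -/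
theorem mul_inv_central_tail {c : G} (hc : c ∈ Subgroup.center G) (g : G) : g * c⁻¹ = c⁻¹ * g :=
  Subgroup.mem_center_iff.1 (Subgroup.inv_mem _ hc) g

/-- Pulling a central inverse to the front: `g (c⁻¹ h) = c⁻¹ (g h)`. -/
theorem mul_inv_central_left {c : G} (hc : c ∈ Subgroup.center G) (g h : G) : g * (c⁻¹ * h) = c⁻¹ * (g * h) := by
  have h1 : g * c⁻¹ = c⁻¹ * g := by
    have := Subgroup.mem_center_iff.1 (Subgroup.inv_mem _ hc) g
    exact this
  rw [← mul_assoc, h1, mul_assoc]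

/-- Pulling a central element to the front: `g (c h) = c (g h)`. -/
theorem mul_central_left {c : G} (hc : c ∈ Subgroup.center G) (g h : G) : g * (c * h) = c * (g * h) := by
  rw [← mul_assoc, Subgroup.mem_center_iff.1 hc g, mul_assoc]

/-- ★ **Plaquette holonomies are invariant under the centre sheet twist** (the sheet links of a
plaquette come in cancelling pairs; `z` central). [folklore] -/
theorem plaquetteHolonomy_sheetTwist {m : Fin d} {z : G} (hz : z ∈ Subgroup.center G) (U : GaugeConfig d L G)
    (x : Site d L) (i j : Fin d) :
    plaquetteHolonomy (sheetTwist m z U) x i j = plaquetteHolonomy U x i j := by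
  unfold plaquetteHolonomy
  simp only [sheetTwist_apply, sheetFactor]
  by_cases hi : i = m
  · subst hi
    by_cases hj : j = i
    · subst hj
      simp only [true_and]
      rw [mul_inv_cancel_right, mul_inv_cancel, mul_inv_cancel_right, mul_inv_cancel]
    · simp only [hj, false_and, if_false, one_mul, true_and, shift_apply_of_ne' x hj]
      by_cases hx : x i = 0
      · simp only [hx, if_true, mul_inv_rev, mul_assoc]
        rw [mul_inv_central_left hz, mul_inv_central_left hz, mul_inv_central_left hz, mul_inv_cancel_left]
      · simp only [hx, if_false, one_mul]
  · by_cases hj : j = m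
    · subst hj
      simp only [hi, false_and, if_false, one_mul, true_and, shift_apply_of_ne' x hi]
      by_cases hx : x j = 0
      · simp only [hx, if_true, mul_inv_rev, mul_assoc]
        rw [mul_inv_central_tail hz, mul_inv_central_left hz, mul_inv_central_left hz, mul_inv_cancel_left]
      · simp only [hx, if_false, one_mul]
    · simp only [hi, hj, false_and, if_false, one_mul]

variable {N : ℕ} (ρ : G →* Matrix (Fin N) (Fin N) ℂ)

/-- **The Wilson action is invariant under the centre sheet twist.** -/
theorem wilsonAction_sheetTwist [NeZero L] {m : Fin d} {z : G} (hz : z ∈ Subgroup.center G) (U : GaugeConfig d L G) :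
    wilsonAction ρ (sheetTwist m z U) = wilsonAction ρ U := by
  unfold wilsonAction
  simp_rw [plaquetteHolonomy_sheetTwist hz]

variable [TopologicalSpace G] [IsTopologicalGroup G]

/-- The sheet twist as a continuous self-map of the configurations. [folklore] -/
def sheetTwistCM (m : Fin d) (z : G) : C(GaugeConfig d L G, GaugeConfig d L G) :=
  ⟨sheetTwist m z, continuous_pi fun e => (continuous_apply e).const_mul _⟩

/-- `sheetTwistCM` evaluated. -/
@[simp] theorem sheetTwistCM_apply (m : Fin d) (z : G) (U : GaugeConfig d L G) :
    sheetTwistCM (L := L) m z U = sheetTwist m z U := rfl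

variable (r : LatticeRep G)

/-- **The polynomial observables are stable under the sheet twist** (each twisted link is a one-link
left shift). -/
theorem comp_sheetTwistCM_mem_polyAlgebra (m : Fin d) (z : G) {f : C(GaugeConfig d L G, ℝ)}
    (hf : f ∈ polyAlgebra (ι := Edge d L) r) : f.comp (sheetTwistCM m z) ∈ polyAlgebra (ι := Edge d L) r := by
  have h : polyAlgebra (ι := Edge d L) r ≤ (polyAlgebra (ι := Edge d L) r).comap
      (ContinuousMap.compRightAlgHom ℝ ℝ (sheetTwistCM (G := G) (L := L) m z)) := by
    refine Algebra.adjoin_le ?_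
    have hgen : ∀ (e : Edge d L) (a b : Fin r.N),
        (reEntry r e a b).comp (sheetTwistCM (G := G) (L := L) m z) = (reEntry r e a b).comp (shiftCM e (sheetFactor m z e)) ∧
        (imEntry r e a b).comp (sheetTwistCM (G := G) (L := L) m z) = (imEntry r e a b).comp (shiftCM e (sheetFactor m z e)) :=
      fun e a b => ⟨by ext U; simp, by ext U; simp⟩
    rintro _ (⟨⟨e, a, b⟩, rfl⟩ | ⟨⟨e, a, b⟩, rfl⟩)
    · change (reEntry r e a b).comp (sheetTwistCM m z) ∈ polyAlgebra (ι := Edge d L) r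
      rw [(hgen e a b).1]
      exact comp_shiftCM_mem_polyAlgebra r e _ (reEntry_mem r e a b)
    · change (imEntry r e a b).comp (sheetTwistCM m z) ∈ polyAlgebra (ι := Edge d L) r
      rw [(hgen e a b).2]
      exact comp_shiftCM_mem_polyAlgebra r e _ (imEntry_mem r e a b)
  exact h hf

variable [CompactSpace G] [MeasurableSpace G] [BorelSpace G] [NeZero L]

/-- The sheet twist as a measurable equivalence (inverse: the twist by `z⁻¹`). -/
def sheetTwistEquiv (m : Fin d) (z : G) : GaugeConfig d L G ≃ᵐ GaugeConfig d L G where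
  toFun := sheetTwist m z
  invFun := sheetTwist m z⁻¹
  left_inv U := sheetTwist_inv_sheetTwist m z U
  right_inv U := sheetTwist_sheetTwist_inv m z U
  measurable_toFun := measurable_pi_lambda _ fun e => (measurable_pi_apply e).const_mul _
  measurable_invFun := measurable_pi_lambda _ fun e => (measurable_pi_apply e).const_mul _

omit [CompactSpace G] [NeZero L] in
/-- `sheetTwistEquiv` as a function. -/
@[simp] theorem coe_sheetTwistEquiv (m : Fin d) (z : G) : ⇑(sheetTwistEquiv (L := L) m z) = sheetTwist m z := rfl

/-- **Product Haar measure is invariant under the sheet twist** (left invariance, link by link). -/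
theorem map_sheetTwistEquiv_pi_haar (m : Fin d) (z : G) :
    (Measure.pi fun _ : Edge d L => haarProbability G).map (sheetTwistEquiv (L := L) m z) =
      Measure.pi fun _ : Edge d L => haarProbability G :=
  (measurePreserving_pi (fun _ : Edge d L => haarProbability G) (fun _ : Edge d L => haarProbability G)
    (f := fun e g => sheetFactor m z e * g) fun e => measurePreserving_mul_left (haarProbability G) (sheetFactor m z e)).map_eq

/-- ★ **The Wilson measure is invariant under the centre sheet twist.** [folklore] -/
theorem measurePreserving_sheetTwistEquiv_wilsonMeasure {m : Fin d} {z : G} (hz : z ∈ Subgroup.center G) (β : ℝ) :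
    MeasurePreserving (sheetTwistEquiv (L := L) m z) (wilsonMeasure (d := d) (L := L) ρ β) (wilsonMeasure ρ β) := by
  refine ⟨(sheetTwistEquiv (L := L) m z).measurable, ?_⟩
  simp only [wilsonMeasure, Measure.map_smul, wilsonWeight]
  rw [withDensity_map_of_measurableEquiv _ _ _ (map_sheetTwistEquiv_pi_haar m z)]
  intro U
  rw [coe_sheetTwistEquiv, wilsonAction_sheetTwist ρ hz]

/-- **Change of variables** under the sheet twist. -/
theorem integral_comp_sheetTwist_eq_wilson {m : Fin d} {z : G} (hz : z ∈ Subgroup.center G) (β : ℝ)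
    (f : C(GaugeConfig d L G, ℝ)) :
    ∫ U, f (sheetTwist m z U) ∂(wilsonMeasure ρ β) = ∫ U, f U ∂(wilsonMeasure (d := d) (L := L) ρ β) :=
  (measurePreserving_sheetTwistEquiv_wilsonMeasure ρ hz β).integral_comp' f

end Twist

/-! ## Polyakov loops pick up one twist factor -/

section Polyakov

variable {d L : ℕ} {G : Type*} [Group G]

/-- **The Polyakov word**: `n` forward steps in direction `m` (the Polyakov loop for `n = L`). [folklore] -/
def polyakovWord (m : Fin d) (n : ℕ) : Word d := List.replicate n (Step.fwd m)

/-- Endpoint of a straight run. -/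
theorem endpoint_polyakovWord (x : Site d L) (m : Fin d) (n : ℕ) :
    Word.endpoint x (polyakovWord m n) = x + Pi.single m (n : ZMod L) := by
  induction n generalizing x with
  | zero => simp [polyakovWord]
  | succ n ih =>
    rw [polyakovWord, List.replicate_succ, Word.endpoint_cons, ← polyakovWord, ih]
    simp only [Step.apply, Site.shift, Nat.cast_succ]
    rw [add_assoc, ← Pi.single_add, add_comm (1 : ZMod L)]

/-- **The Polyakov loop is closed**: `L` steps in direction `m` return to the base point. -/
theorem endpoint_polyakovWord_self (x : Site d L) (m : Fin d) : Word.endpoint x (polyakovWord m L) = x := by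
  rw [endpoint_polyakovWord, ZMod.natCast_self, Pi.single_zero, add_zero]

/-- A straight run which does not start on the sheet and is short enough not to reach it sees no
twist. -/
theorem wordHolonomy_polyakovWord_sheetTwist_of_not_cross (m : Fin d) (z : G) (U : GaugeConfig d L G) :
    ∀ (n : ℕ) (x : Site d L), (∀ k : ℕ, k < n → (x + Pi.single m (k : ZMod L) : Site d L) m ≠ 0) →
      wordHolonomy (sheetTwist m z U) x (polyakovWord m n) = wordHolonomy U x (polyakovWord m n) := by
  intro n
  induction n with
  | zero => intro x _; simp [polyakovWord]
  | succ n ih =>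
    intro x hx
    rw [polyakovWord, List.replicate_succ, wordHolonomy_cons, wordHolonomy_cons, ← polyakovWord]
    have h0 : x m ≠ 0 := by simpa using hx 0 (Nat.succ_pos n)
    have hstep : stepHolonomy (sheetTwist m z U) x (Step.fwd m) = stepHolonomy U x (Step.fwd m) := by
      rw [stepHolonomy_fwd, stepHolonomy_fwd, sheetTwist_apply, sheetFactor, if_neg (fun h => h0 h.2), one_mul]
    rw [hstep, ih]
    intro k hk
    have := hx (k + 1) (Nat.succ_lt_succ hk)
    simpa [Step.apply, Site.shift, add_assoc, ← Pi.single_add, add_comm (1 : ZMod L), Nat.cast_succ] using this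

/-- ★ **A Polyakov loop based ON the sheet picks up exactly one factor `z`**:
`hol_x(P_m)(twisted U) = z · hol_x(P_m)(U)` for `x_m = 0`, `L ≥ 1`. [folklore] -/
theorem wordHolonomy_polyakov_sheetTwist [NeZero L] (m : Fin d) (z : G) (U : GaugeConfig d L G) {x : Site d L}
    (hx : x m = 0) :
    wordHolonomy (sheetTwist m z U) x (polyakovWord m L) = z * wordHolonomy U x (polyakovWord m L) := by
  have hL : polyakovWord (d := d) m L = Step.fwd m :: polyakovWord m (L - 1) := by
    rw [polyakovWord, polyakovWord, ← List.replicate_succ, Nat.sub_one_add_one (NeZero.ne L)]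
  rw [hL, wordHolonomy_cons, wordHolonomy_cons]
  have hstep : stepHolonomy (sheetTwist m z U) x (Step.fwd m) = z * stepHolonomy U x (Step.fwd m) := by
    rw [stepHolonomy_fwd, stepHolonomy_fwd, sheetTwist_apply, sheetFactor, if_pos ⟨rfl, hx⟩]
  rw [hstep, mul_assoc, wordHolonomy_polyakovWord_sheetTwist_of_not_cross m z U (L - 1)]
  intro k hk
  simp only [Step.apply, Site.shift, Pi.add_apply, Pi.single_eq_same, hx, zero_add]
  rw [← Nat.cast_one, ← Nat.cast_add, Ne, ZMod.natCast_eq_zero_iff]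
  intro hdvd
  have := Nat.le_of_dvd (by omega) hdvd
  omega

end Polyakov

/-! ## `SU(N)` and `U(N)`: every solution is invariant under every centre sheet twist -/

section Unitary

open Literature.MathematicalPhysics.QuantumLattice

variable {d L : ℕ} [NeZero L] (N : ℕ) (β : ℝ)

/-- ★★★ **`SU(N)`: every solution of the untruncated bootstrap is invariant under every centre sheet
twist** (any central `z ∈ SU(N)`, any direction, every real `β`). [folklore] -/
theorem bootstrap_sheetTwistInvariant_suN (m : Fin d) {z : Matrix.specialUnitaryGroup (Fin N) ℂ}
    (hz : z ∈ Subgroup.center (Matrix.specialUnitaryGroup (Fin N) ℂ))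
    {φ : C(GaugeConfig d L (Matrix.specialUnitaryGroup (Fin N) ℂ), ℝ) →ₗ[ℝ] ℝ} (h1 : φ 1 = 1)
    (hpos : ∀ a ∈ polyAlgebra (ι := Edge d L) (fundamentalLatticeRep N), 0 ≤ φ (a * a))
    (hφ : IsSDFunctional (fundamentalLatticeRep N) (suExp N) (fun _ => wilsonAction (fundamentalRep (Fin N))) β φ)
    {f : C(GaugeConfig d L (Matrix.specialUnitaryGroup (Fin N) ℂ), ℝ)}
    (hf : f ∈ polyAlgebra (ι := Edge d L) (fundamentalLatticeRep N)) :
    φ (f.comp (sheetTwistCM m z)) = φ f :=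
  bootstrap_invariant_suN N β h1 hpos hφ _
    (fun g => integral_comp_sheetTwist_eq_wilson (fundamentalRep (Fin N)) hz β g)
    (fun _ hg => comp_sheetTwistCM_mem_polyAlgebra _ m z hg) hf

/-- ★★★ **`U(N)`: every solution of the untruncated bootstrap is invariant under every centre sheet
twist.** [folklore] -/
theorem bootstrap_sheetTwistInvariant_uN (m : Fin d) {z : Matrix.unitaryGroup (Fin N) ℂ}
    (hz : z ∈ Subgroup.center (Matrix.unitaryGroup (Fin N) ℂ))
    {φ : C(GaugeConfig d L (Matrix.unitaryGroup (Fin N) ℂ), ℝ) →ₗ[ℝ] ℝ} (h1 : φ 1 = 1)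
    (hpos : ∀ a ∈ polyAlgebra (ι := Edge d L) (unitaryFundamentalLatticeRep N), 0 ≤ φ (a * a))
    (hφ : IsSDFunctional (unitaryFundamentalLatticeRep N) (uExp N)
      (fun _ => wilsonAction (unitaryFundamentalRep (Fin N) ℂ)) β φ)
    {f : C(GaugeConfig d L (Matrix.unitaryGroup (Fin N) ℂ), ℝ)}
    (hf : f ∈ polyAlgebra (ι := Edge d L) (unitaryFundamentalLatticeRep N)) :
    φ (f.comp (sheetTwistCM m z)) = φ f :=
  bootstrap_invariant_uN N β h1 hpos hφ _
    (fun g => integral_comp_sheetTwist_eq_wilson (unitaryFundamentalRep (Fin N) ℂ) hz β g)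
    (fun _ hg => comp_sheetTwistCM_mem_polyAlgebra _ m z hg) hf

end Unitary

end Summit.QuantumFields.GaugeBoot

end
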